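import Literature.Computability.AlgebraicComplexity.USPCapacityUpperBound
import Literature.Computability.AlgebraicComplexity.LaserMethodTypeCount
import Mathlib.Analysis.SpecialFunctions.Pow.Real
import Mathlib.Analysis.SpecificLimits.Normed
import HarnessLib

/-!
# The USP capacity equals `3/2^{2/3}` (Cohn–Kleinberg–Szegedy–Umans 2005, Theorem 3.3 / 13, after
Coppersmith–Winograd 1990 §6) — the LOWER half, and the theorem as printed

Topic `Literature/Computability/AlgebraicComplexity` (group-theoretic matrix multiplication).
Companion of `USPCapacityUpperBound.lean` (CKSU Lemma 3.2 / 12: "The USP capacity is at most `3/2^{2/3}`",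
`IsUSP.eventually_card_lt_pow`).  Cohn–Kleinberg–Szegedy–Umans (FOCS 2005 §3.2; arXiv:math/0511460 §3,
text p. 6) continue, AS PRINTED:

> "USPs turn out to be implicit in the analysis in Coppersmith and Winograd's paper [CW], although they
> are not discussed as such. Section 6 of [CW] can be interpreted as giving a probabilistic construction
> showing that Lemma 3.2 is sharp: **Theorem 3.3 (Coppersmith and Winograd [CW]).** The USP capacity
> equals `3/2^{2/3}`."

(USP capacity: "the largest constant `C` such that there exist USPs of size `(C − o(1))^k` and width `k`
for infinitely many values of `k`", §3.1 p. 5.)  This file PROVES the lower half in the `∀ C`-unfolding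
used throughout the tree (`exists_isStrongUSP_card_ge_pow`, `IsUSP.eventually_card_lt_pow`):

* `exists_localUSP_card_ge_pow` — for every `0 < C < 3/2^{2/3}` and every `K` there is a LOCAL USP
  (CKSU §6.2: every ordered triple of rows, not all equal, has a column with pattern in `L ∪ {(1,2,3)}`,
  the tree's `insert (0,1,2) localStrongUSPPatterns`) of some width `k ≥ K` with at least `C^k` rows —
  "Local USPs … achieve the USP capacity" (§6.2 p. 11), here directly from the construction;
* `isUSP_of_localUSP` — "Local USPs are USPs" (§6.2); `exists_isUSP_card_ge_pow` — for every
  `0 ≤ C < 3/2^{2/3}` and every `K` there is a USP of some width `k ≥ K` with at least `C^k` rows;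
* `CohnKleinbergSzegedyUmans2005_thm13` — Theorem 3.3 / 13 as printed: both halves together.

The proof is Coppersmith–Winograd's construction, run through the tree's formalisation of the laser
method's combinatorial core (`LaserMethodTypeCount.lean`: `exists_free_diagonal_jointType_card` =
BCS 1997 Thm. 15.39 relative hashing with a Bertrand prime and a Salem–Spencer set, Behrend's bound,
inside one joint type; Le Gall 2014 Lemma A.2):

1. (`localUSP_of_freeDiagonal` / `isUSP_of_freeDiagonal`, the combinatorial core, proved here) rows of
   `{1,2,3}^N`, `N = 3n`, are
   coded as triples `(x,y,z)` of indicator words with exactly one of `x_ρ, y_ρ, z_ρ` true at each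
   coordinate; if every row is balanced (`n` of each symbol) and the set `Δ` of rows is a FREE DIAGONAL —
   "the `1`-set of `δ`, the `2`-set of `δ'` and the `3`-set of `δ''` partition `[N]` only if
   `δ = δ' = δ''`" — then `Δ` is a USP: given `π₁, π₂, π₃ ∈ Sym(Δ)` with no cell carrying two of
   `(π₁u)ᵢ = 1, (π₂u)ᵢ = 2, (π₃u)ᵢ = 3`, the `n + n + n = N` incidences, at most one per cell, are exactly
   one per cell, i.e. a partition, so freeness forces `π₁ u = π₂ u = π₃ u` for all `u` (this is the
   "puzzle" reading of §3.1: a USP is a puzzle with a unique solution).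
2. The free diagonal is supplied by `exists_free_diagonal_jointType_card` for the support
   `S = {(1,0,0),(0,1,0),(0,0,1)} ⊆ {0,1}³` (tight with the labels `t ↦ 2·[t] − 1`), the joint type
   `Q = (n,n,n)` and `P = Q/N`: all three marginals of `P` are `(1/3, 2/3)`, so
   `min_m H(P_m) = H(1/3) = log₂ 3 − 2/3`, and the penalty `Γ_S(P) = max_{Q' ∈ D(P)} H(Q') − H(P)`
   vanishes because a distribution on `S` is determined by its marginals (`D(P) = {P}`); hence
   `|Δ| ≥ 2^{N H(1/3)} / ((N+1)^{22} · 192 · e^{4√(log 6 + N log 8)})`.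
3. `2^{H(1/3)} = 3/2^{2/3}` (`two_rpow_entropy_third`) and the sub-exponential loss is absorbed into
   `(3/(2^{2/3} C))^N` for `N` large (three elementary "eventually" lemmas).

No new definitions, no named facts; everything is proved.  NOT formalised: the consequence "Using
Theorem 3.3, this example achieves `ω < 2.41`" (Thm. 6.6 / 37 with Coppersmith–Winograd's `H`-chart),
and the strong-USP analogue (Conjecture 3.4 / 14, open).

## References
* H. Cohn, R. Kleinberg, B. Szegedy, C. Umans, *Group-theoretic algorithms for matrix multiplication*,
  FOCS 2005, 379–388; arXiv:math/0511460 (Thm. 3.3 = arXiv Thm. 13, §3, held text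
  `paper:arxiv-math_0511460` p. 6 L34–L42; capacity definition p. 5 L150–L156).
  [CohnKleinbergSzegedyUmans2005]
* D. Coppersmith, S. Winograd, *Matrix multiplication via arithmetic progressions*, J. Symbolic
  Comput. 9 (1990) 251–280, §6 (the probabilistic construction; cited through CKSU).
* P. Bürgisser, M. Clausen, M. A. Shokrollahi, *Algebraic Complexity Theory* (1997), Thm. 15.39
  (the tree's `BCS1997_thm1539_free_sub`). [BurgisserClausenShokrollahi1997]
* F. Le Gall, *Powers of tensors and fast matrix multiplication*, ISSAC 2014, Lemma A.2 (the tree's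
  `exists_free_diagonal_jointType_card`). [LeGall2014]
-/

noncomputable section

namespace Literature.Computability.AlgebraicComplexity

open Finset

/-! ## From a free diagonal of balanced words to a USP (the combinatorial core) -/

section Core

variable {N : ℕ}

/-- "at most one of `a = 1, b = 2, c = 3`" as an indicator count. [folklore] -/
private theorem not_uspAtLeastTwo_iff_indicator (a b c : Fin 3) :
    ¬ USPAtLeastTwo a b c ↔
      (if a = 0 then 1 else 0) + (if b = 1 then 1 else 0) + (if c = 2 then 1 else 0) ≤ (1 : ℕ) := by
  revert a b c; decide

/-- The row of `{1,2,3}^N` (coded `0,1,2`) attached to a triple of indicator words `(x,y,z)`: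
symbol `1` where `x` holds, else `2` where `y` holds, else `3`; when exactly one of `x_ρ, y_ρ, z_ρ`
holds, the row shows symbol `a` at `ρ` iff the `a`-th indicator holds. [folklore] -/
private theorem rowOfTriple_cases (δ : (Fin N → Bool) × (Fin N → Bool) × (Fin N → Bool)) (ρ : Fin N)
    (hone : (δ.1 ρ, δ.2.1 ρ, δ.2.2 ρ) ∈
      ({(true, false, false), (false, true, false), (false, false, true)} : Finset (Bool × Bool × Bool))) :
    ((if δ.1 ρ then (0 : Fin 3) else if δ.2.1 ρ then 1 else 2) = 0 ↔ δ.1 ρ = true) ∧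
    ((if δ.1 ρ then (0 : Fin 3) else if δ.2.1 ρ then 1 else 2) = 1 ↔ δ.2.1 ρ = true) ∧
    ((if δ.1 ρ then (0 : Fin 3) else if δ.2.1 ρ then 1 else 2) = 2 ↔ δ.2.2 ρ = true) := by
  simp only [Finset.mem_insert, Finset.mem_singleton, Prod.mk.injEq] at hone
  rcases hone with ⟨h1, h2, h3⟩ | ⟨h1, h2, h3⟩ | ⟨h1, h2, h3⟩ <;> simp [h1, h2, h3]

/-- Counting step: a function `f : Fin N → ℕ` with `f ρ ≤ 1` for all `ρ` and `∑ f = N` is identically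
`1`. [folklore] -/
private theorem eq_one_of_le_one_of_sum_eq {f : Fin N → ℕ} (hle : ∀ ρ, f ρ ≤ 1) (hsum : ∑ ρ, f ρ = N)
    (ρ : Fin N) : f ρ = 1 := by
  by_contra hne
  have hlt : f ρ < 1 := lt_of_le_of_ne (hle ρ) hne
  have : ∑ ρ', f ρ' < ∑ _ρ' : Fin N, (1 : ℕ) :=
    Finset.sum_lt_sum (fun ρ' _ => hle ρ') ⟨ρ, Finset.mem_univ _, hlt⟩
  rw [hsum, Finset.sum_const, Finset.card_univ, Fintype.card_fin, smul_eq_mul, mul_one] at this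
  exact lt_irrefl _ this

/-- CKSU's local-USP pattern set `L ∪ {(1,2,3)}` (§6.2: "the triple `(1,2,3)` is allowed in addition to
`(1,2,1), (1,2,2), (1,1,3), (1,3,3), (2,2,3), (3,2,3)`") is exactly "at least two of `x = 1, y = 2, z = 3`"
(`27` cases). [cite: CohnKleinbergSzegedyUmans2005, §6.2 (arXiv:math/0511460 p. 11), definition of a local USP] -/
theorem uspAtLeastTwo_iff_mem_localUSPPatterns (x y z : Fin 3) :
    USPAtLeastTwo x y z ↔ (x, y, z) ∈ insert ((0 : Fin 3), (1 : Fin 3), (2 : Fin 3)) localStrongUSPPatterns := by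
  revert x y z; decide

/-- **"Local USPs are USPs"** (CKSU 2005 §6.2, "the proofs are analogous to those for Lemma 32"): if every
ordered triple of rows, not all equal, has a column whose pattern lies in `L ∪ {(1,2,3)}`, the puzzle is a USP —
given `π₁, π₂, π₃` not all equal, apply the hypothesis to `(π₁ u, π₂ u, π₃ u)` for a row `u` they move
differently. [cite: CohnKleinbergSzegedyUmans2005, §6.2 (arXiv:math/0511460 p. 11), "Local USPs are USPs"] -/
theorem isUSP_of_localUSP {s k : ℕ} {row : Fin s → Fin k → Fin 3}
    (hU : ∀ a b c : Fin s, (a ≠ b ∨ b ≠ c) → ∃ i : Fin k, (row a i, row b i, row c i) ∈ insert ((0 : Fin 3), (1 : Fin 3), (2 : Fin 3)) localStrongUSPPatterns) :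
    IsUSP row := by
  intro π₁ π₂ π₃
  by_cases h : π₁ = π₂ ∧ π₂ = π₃
  · exact Or.inl h
  · right
    -- some row is moved differently by two of the permutations
    have : ∃ u : Fin s, π₁ u ≠ π₂ u ∨ π₂ u ≠ π₃ u := by
      by_contra hall
      simp only [not_exists, not_or, not_not] at hall
      exact h ⟨Equiv.ext fun u => (hall u).1, Equiv.ext fun u => (hall u).2⟩
    obtain ⟨u, hu⟩ := this
    obtain ⟨i, hi⟩ := hU (π₁ u) (π₂ u) (π₃ u) hu
    exact ⟨u, i, (uspAtLeastTwo_iff_mem_localUSPPatterns _ _ _).2 hi⟩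

/-- The counting step of the core, for ONE triple of balanced rows: if at no coordinate two of
"`1`-indicator of `a`", "`2`-indicator of `b`", "`3`-indicator of `c`" hold, then (`n + n + n = N` incidences,
at most one per coordinate) exactly one holds at every coordinate, i.e. the three sets partition `[N]`.
[cite: CohnKleinbergSzegedyUmans2005, Theorem 13 (§3), proof ("puzzle" counting)] -/
theorem partition_of_forall_not_uspAtLeastTwo {n : ℕ} (hN : N = 3 * n)
    (a b c : (Fin N → Bool) × (Fin N → Bool) × (Fin N → Bool))
    (ha : ∀ ρ, (a.1 ρ, a.2.1 ρ, a.2.2 ρ) ∈ ({(true, false, false), (false, true, false), (false, false, true)} : Finset (Bool × Bool × Bool)))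
    (hb : ∀ ρ, (b.1 ρ, b.2.1 ρ, b.2.2 ρ) ∈ ({(true, false, false), (false, true, false), (false, false, true)} : Finset (Bool × Bool × Bool)))
    (hc : ∀ ρ, (c.1 ρ, c.2.1 ρ, c.2.2 ρ) ∈ ({(true, false, false), (false, true, false), (false, false, true)} : Finset (Bool × Bool × Bool)))
    (hca : letterCount a.1 true = n) (hcb : letterCount b.2.1 true = n) (hcc : letterCount c.2.2 true = n)
    (hcell : ∀ ρ, ¬ USPAtLeastTwo (if a.1 ρ then (0 : Fin 3) else if a.2.1 ρ then 1 else 2)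
      (if b.1 ρ then (0 : Fin 3) else if b.2.1 ρ then 1 else 2)
      (if c.1 ρ then (0 : Fin 3) else if c.2.1 ρ then 1 else 2)) :
    ∀ ρ, (a.1 ρ, b.2.1 ρ, c.2.2 ρ) ∈ ({(true, false, false), (false, true, false), (false, false, true)} : Finset (Bool × Bool × Bool)) := by
  classical
  -- indicator count per cell
  let f : Fin N → ℕ := fun ρ =>
    (if a.1 ρ = true then 1 else 0) + (if b.2.1 ρ = true then 1 else 0) + (if c.2.2 ρ = true then 1 else 0)
  have hle : ∀ ρ, f ρ ≤ 1 := by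
    intro ρ
    have hρ := hcell ρ
    rw [not_uspAtLeastTwo_iff_indicator] at hρ
    have ea := (rowOfTriple_cases a ρ (ha ρ)).1
    have eb := (rowOfTriple_cases b ρ (hb ρ)).2.1
    have ec := (rowOfTriple_cases c ρ (hc ρ)).2.2
    simp only [f]
    simp only [ea, eb, ec] at hρ
    exact hρ
  have hsum : ∑ ρ, f ρ = N := by
    simp only [f, Finset.sum_add_distrib]
    rw [letterCount_apply] at hca hcb hcc
    rw [← Finset.card_filter, ← Finset.card_filter, ← Finset.card_filter, hca, hcb, hcc]
    omega
  have hall : ∀ ρ, f ρ = 1 := eq_one_of_le_one_of_sum_eq hle hsum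
  intro ρ
  have h := hall ρ
  simp only [f] at h
  revert h
  generalize a.1 ρ = p
  generalize b.2.1 ρ = q
  generalize c.2.2 ρ = r
  revert p q r
  decide

/-- **The combinatorial core of CKSU Theorem 3.3 / 13, local form.**  Let `Δ` be a set of triples
`(x,y,z)` of indicator words of length `N = 3n` such that (i) at every coordinate exactly one of `x, y, z`
holds and each holds at exactly `n` coordinates (balanced rows of `{1,2,3}^N`), and (ii) `Δ` is a FREE
DIAGONAL: whenever the `1`-set of `δ`, the `2`-set of `δ'` and the `3`-set of `δ''` partition `[N]`,
`δ = δ' = δ''`.  Then the rows of `Δ` form a LOCAL USP (CKSU §6.2): every ordered triple of rows, not all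
equal, has a column with at least two of `a_i = 1, b_i = 2, c_i = 3` — otherwise counting forces a
partition and freeness gives `a = b = c`.
[cite: CohnKleinbergSzegedyUmans2005, §6.2 (arXiv:math/0511460 p. 11), "Local USPs … achieve the USP capacity"] -/
theorem localUSP_of_freeDiagonal {n : ℕ} (hN : N = 3 * n)
    (Δ : Finset ((Fin N → Bool) × (Fin N → Bool) × (Fin N → Bool)))
    (hone : ∀ δ ∈ Δ, ∀ ρ, (δ.1 ρ, δ.2.1 ρ, δ.2.2 ρ) ∈ ({(true, false, false), (false, true, false), (false, false, true)} : Finset (Bool × Bool × Bool)))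
    (hcount : ∀ δ ∈ Δ, letterCount δ.1 true = n ∧ letterCount δ.2.1 true = n ∧ letterCount δ.2.2 true = n)
    (hfree : ∀ δ ∈ Δ, ∀ δ' ∈ Δ, ∀ δ'' ∈ Δ, (∀ ρ, (δ.1 ρ, δ'.2.1 ρ, δ''.2.2 ρ) ∈ ({(true, false, false), (false, true, false), (false, false, true)} : Finset (Bool × Bool × Bool))) →
        δ = δ' ∧ δ' = δ'')
    {s : ℕ} (e : Fin s ≃ Δ) :
    ∀ a b c : Fin s, (a ≠ b ∨ b ≠ c) → ∃ i : Fin N,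
      ((if (e a).1.1 i then (0 : Fin 3) else if (e a).1.2.1 i then 1 else 2),
        (if (e b).1.1 i then (0 : Fin 3) else if (e b).1.2.1 i then 1 else 2),
        (if (e c).1.1 i then (0 : Fin 3) else if (e c).1.2.1 i then 1 else 2)) ∈ insert ((0 : Fin 3), (1 : Fin 3), (2 : Fin 3)) localStrongUSPPatterns := by
  classical
  intro a b c hne
  by_contra H
  simp only [not_exists] at H
  have hcell : ∀ ρ, ¬ USPAtLeastTwo (if (e a).1.1 ρ then (0 : Fin 3) else if (e a).1.2.1 ρ then 1 else 2)
      (if (e b).1.1 ρ then (0 : Fin 3) else if (e b).1.2.1 ρ then 1 else 2)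
      (if (e c).1.1 ρ then (0 : Fin 3) else if (e c).1.2.1 ρ then 1 else 2) :=
    fun ρ hρ => H ρ ((uspAtLeastTwo_iff_mem_localUSPPatterns _ _ _).1 hρ)
  have hpart := partition_of_forall_not_uspAtLeastTwo hN (e a).1 (e b).1 (e c).1
    (hone _ (e a).2) (hone _ (e b).2) (hone _ (e c).2)
    (hcount _ (e a).2).1 (hcount _ (e b).2).2.1 (hcount _ (e c).2).2.2 hcell
  obtain ⟨hab, hbc⟩ := hfree _ (e a).2 _ (e b).2 _ (e c).2 hpart
  have hab' : a = b := e.injective (Subtype.ext hab)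
  have hbc' : b = c := e.injective (Subtype.ext hbc)
  exact hne.elim (fun h => h hab') (fun h => h hbc')

/-- **The combinatorial core of CKSU Theorem 3.3 / 13 (Coppersmith–Winograd's USPs).**  Let `Δ` be a
set of triples `(x,y,z)` of indicator words of length `N = 3n` such that (i) at every coordinate exactly
one of `x, y, z` holds and each holds at exactly `n` coordinates (balanced rows of `{1,2,3}^N`), and
(ii) `Δ` is a FREE DIAGONAL: whenever the `1`-set of `δ`, the `2`-set of `δ'` and the `3`-set of `δ''`
partition `[N]`, `δ = δ' = δ''`.  Then the rows of `Δ` form a USP: for permutations `π₁, π₂, π₃` with no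
cell satisfying two of `(π₁u)ᵢ = 1, (π₂u)ᵢ = 2, (π₃u)ᵢ = 3`, counting (`n + n + n = N` conditions hold in
total, at most one per cell) forces exactly one per cell, i.e. a partition, so freeness gives
`π₁ u = π₂ u = π₃ u` for every `u` (via the local form `localUSP_of_freeDiagonal` and "local USPs are
USPs").
[cite: CohnKleinbergSzegedyUmans2005, Theorem 13 (§3; "Section 6 of [CW] … probabilistic construction")] -/
theorem isUSP_of_freeDiagonal {n : ℕ} (hN : N = 3 * n)
    (Δ : Finset ((Fin N → Bool) × (Fin N → Bool) × (Fin N → Bool)))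
    (hone : ∀ δ ∈ Δ, ∀ ρ, (δ.1 ρ, δ.2.1 ρ, δ.2.2 ρ) ∈
      ({(true, false, false), (false, true, false), (false, false, true)} : Finset (Bool × Bool × Bool)))
    (hcount : ∀ δ ∈ Δ, letterCount δ.1 true = n ∧ letterCount δ.2.1 true = n ∧ letterCount δ.2.2 true = n)
    (hfree : ∀ δ ∈ Δ, ∀ δ' ∈ Δ, ∀ δ'' ∈ Δ, (∀ ρ, (δ.1 ρ, δ'.2.1 ρ, δ''.2.2 ρ) ∈
      ({(true, false, false), (false, true, false), (false, false, true)} : Finset (Bool × Bool × Bool))) →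
        δ = δ' ∧ δ' = δ'')
    {s : ℕ} (e : Fin s ≃ Δ) :
    IsUSP (fun (u : Fin s) (ρ : Fin N) =>
      if (e u).1.1 ρ then (0 : Fin 3) else if (e u).1.2.1 ρ then 1 else 2) :=
  isUSP_of_localUSP (localUSP_of_freeDiagonal hN Δ hone hcount hfree e)

end Core

/-! ## The entropy constant `H(1/3, 2/3) = log₂ 3 − 2/3`, i.e. `2^{H} = 3/2^{2/3}` -/

section Entropy

open Real

/-- `2^{(negMulLog(1/3) + negMulLog(2/3))/log 2} = 3 / 2^{2/3}`: the binary entropy of `1/3` is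
`log₂ (3/2^{2/3})`. [folklore] -/
private theorem two_rpow_entropy_third :
    (2 : ℝ) ^ ((negMulLog (1 / 3 : ℝ) + negMulLog (2 / 3)) / Real.log 2) = 3 / (2 : ℝ) ^ (2 / 3 : ℝ) := by
  have hlog2 : Real.log 2 ≠ 0 := by positivity
  have hnum : negMulLog (1 / 3 : ℝ) + negMulLog (2 / 3) = Real.log 3 - 2 / 3 * Real.log 2 := by
    simp only [negMulLog]
    rw [one_div, Real.log_inv, Real.log_div (by norm_num) (by norm_num)]
    ring
  rw [hnum, Real.rpow_def_of_pos two_pos, Real.rpow_def_of_pos two_pos]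
  rw [show Real.log 2 * ((Real.log 3 - 2 / 3 * Real.log 2) / Real.log 2) =
      Real.log 3 - Real.log 2 * (2 / 3) by field_simp]
  rw [Real.exp_sub, Real.exp_log (by norm_num : (0 : ℝ) < 3)]

end Entropy

/-! ## The analytic absorption of the sub-exponential losses -/

section Analytic

open Real

/-- A constant is eventually below `r^N` (`r > 1`). [folklore] -/
private theorem const_le_pow_eventually {r : ℝ} (hr : 1 < r) (c : ℝ) :
    ∃ N₀ : ℕ, ∀ N ≥ N₀, c ≤ r ^ N := by
  obtain ⟨n, hn⟩ := pow_unbounded_of_one_lt c hr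
  exact ⟨n, fun N hN => hn.le.trans (pow_le_pow_right₀ hr.le hN)⟩

/-- `(N+1)^22 ≤ r^N` eventually (`r > 1`). [folklore] -/
private theorem pow22_le_pow_eventually {r : ℝ} (hr : 1 < r) :
    ∃ N₀ : ℕ, ∀ N ≥ N₀, ((N : ℝ) + 1) ^ 22 ≤ r ^ N := by
  have hrpos : 0 < r := lt_trans one_pos hr
  have ht := (tendsto_pow_const_div_const_pow_of_one_lt 22 hr).comp (Filter.tendsto_add_atTop_nat 1)
  have hev := Filter.Tendsto.eventually_lt_const (show (0 : ℝ) < 1 / r by positivity) ht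
  obtain ⟨K, hK⟩ := Filter.eventually_atTop.1 hev
  refine ⟨K, fun N hN => ?_⟩
  have h := hK N hN
  simp only [Function.comp, Nat.cast_add, Nat.cast_one] at h
  rw [div_lt_div_iff₀ (pow_pos hrpos _) hrpos, one_mul, pow_succ] at h
  exact (lt_of_mul_lt_mul_right h hrpos.le).le

/-- `exp(4 √(a + N b)) ≤ r^N` eventually (`r > 1`, `a ≥ 0`): for `N ≥ 16(a+b)/(log r)²` (and
`N ≥ 1`) one has `16 (a + b N) ≤ (log r)² N²`. [folklore] -/
private theorem exp_sqrt_le_pow_eventually {r a b : ℝ} (hr : 1 < r) (ha : 0 ≤ a) :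
    ∃ N₀ : ℕ, ∀ N ≥ N₀, Real.exp (4 * √(a + N * b)) ≤ r ^ N := by
  have hL : 0 < Real.log r := Real.log_pos hr
  obtain ⟨N₀, hN₀⟩ := exists_nat_ge (16 * (a + b) / Real.log r ^ 2)
  refine ⟨max N₀ 1, fun N hN => ?_⟩
  have hN1 : (1 : ℝ) ≤ N := by exact_mod_cast le_trans (le_max_right _ _) hN
  have hNge : 16 * (a + b) / Real.log r ^ 2 ≤ N := le_trans hN₀ (by exact_mod_cast le_trans (le_max_left _ _) hN)
  have hL2 : 0 < Real.log r ^ 2 := by positivity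
  have h16 : 16 * (a + b) ≤ Real.log r ^ 2 * N := by
    rw [div_le_iff₀ hL2] at hNge; linarith
  -- 16 (a + N b) ≤ (log r)² N²
  have hkey : a + N * b ≤ (Real.log r * N / 4) ^ 2 := by
    have h1 : a + N * b ≤ (a + b) * N := by nlinarith
    have h2 : (a + b) * N * 16 ≤ Real.log r ^ 2 * N * N := by nlinarith
    nlinarith
  have hsq : √(a + N * b) ≤ Real.log r * N / 4 := by
    calc √(a + N * b) ≤ √((Real.log r * N / 4) ^ 2) := Real.sqrt_le_sqrt hkey
      _ = Real.log r * N / 4 := Real.sqrt_sq (by positivity)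
  calc Real.exp (4 * √(a + N * b)) ≤ Real.exp (N * Real.log r) := by
        apply Real.exp_le_exp.2; nlinarith
    _ = r ^ N := by rw [Real.exp_nat_mul, Real.exp_log (lt_trans one_pos hr)]

end Analytic

/-! ## Theorem 3.3 / 13: the USP capacity is at least `3/2^{2/3}` -/

section Main

open Real

/-- **"Local USPs … achieve the USP capacity"** (CKSU 2005 §6.2, p. 11), in the strong explicit form
produced by Coppersmith–Winograd's construction: for every `0 < C < 3/2^{2/3}` and every `K` there is a
LOCAL USP (every ordered triple of rows, not all equal, has a column with pattern in `L ∪ {(1,2,3)}`) of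
some width `k ≥ K` with at least `C^k` rows.  Construction ("Section 6 of [CW] can be interpreted as
giving a probabilistic construction showing that Lemma 3.2 is sharp"): the balanced rows of `{1,2,3}^{3n}`
(type `(n,n,n)`), a FREE DIAGONAL extracted by Coppersmith–Winograd hashing with a Salem–Spencer set (the
tree's `exists_free_diagonal_jointType_card` = BCS Thm. 15.39 / Le Gall Lemma A.2 with Behrend's bound:
`|Δ| ≥ 2^{3n·H(1/3) − o(n)}`, the penalty `Γ_S` vanishing because a distribution on the three unit vectors
is determined by its marginals), `localUSP_of_freeDiagonal`, and `2^{H(1/3)} = 3/2^{2/3}`.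
[cite: CohnKleinbergSzegedyUmans2005, §6.2 (arXiv:math/0511460 p. 11) and Theorem 13 (§3, p. 6)] -/
theorem exists_localUSP_card_ge_pow (C : ℝ) (hCpos : 0 < C) (hC : C < 3 / (2 : ℝ) ^ (2 / 3 : ℝ)) (K : ℕ) :
    ∃ k ≥ K, ∃ s : ℕ, ∃ row : Fin s → Fin k → Fin 3,
      (∀ a b c : Fin s, (a ≠ b ∨ b ≠ c) → ∃ i : Fin k, (row a i, row b i, row c i) ∈
        insert ((0 : Fin 3), (1 : Fin 3), (2 : Fin 3)) localStrongUSPPatterns) ∧ C ^ k ≤ (s : ℝ) := by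
  classical
  -- constants `C < C₁ < C₂ < c₀ = 3/2^{2/3}` and the three ratios `> 1`
  set c₀ : ℝ := 3 / (2 : ℝ) ^ (2 / 3 : ℝ) with hc₀
  have hc₀pos : 0 < c₀ := by positivity
  set C₁ : ℝ := (2 * C + c₀) / 3 with hC₁
  set C₂ : ℝ := (C + 2 * c₀) / 3 with hC₂
  have hCC₁ : C < C₁ := by rw [hC₁]; linarith
  have hC₁C₂ : C₁ < C₂ := by rw [hC₁, hC₂]; linarith
  have hC₂c₀ : C₂ < c₀ := by rw [hC₂]; linarith
  have hC₁pos : 0 < C₁ := lt_trans hCpos hCC₁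
  have hC₂pos : 0 < C₂ := lt_trans hC₁pos hC₁C₂
  have hr₁ : 1 < C₁ / C := (one_lt_div hCpos).2 hCC₁
  have hr₂ : 1 < C₂ / C₁ := (one_lt_div hC₁pos).2 hC₁C₂
  have hr₃ : 1 < c₀ / C₂ := (one_lt_div hC₂pos).2 hC₂c₀
  obtain ⟨N₁, hN₁⟩ := const_le_pow_eventually hr₁ 192
  obtain ⟨N₂, hN₂⟩ := pow22_le_pow_eventually hr₂
  obtain ⟨N₃, hN₃⟩ := exp_sqrt_le_pow_eventually (a := Real.log 6) (b := Real.log 8) hr₃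
    (Real.log_nonneg (by norm_num))
  -- the width `N = 3n`
  set n : ℕ := max (max (max K N₁) (max N₂ N₃)) 1 with hn
  have hn1 : 1 ≤ n := le_max_right _ _
  have hnK : K ≤ n := le_trans (le_trans (le_max_left _ _) (le_max_left _ _)) (le_max_left _ _)
  have hnN₁ : N₁ ≤ n := le_trans (le_trans (le_max_right _ _) (le_max_left _ _)) (le_max_left _ _)
  have hnN₂ : N₂ ≤ n := le_trans (le_trans (le_max_left _ _) (le_max_right _ _)) (le_max_left _ _)
  have hnN₃ : N₃ ≤ n := le_trans (le_trans (le_max_right _ _) (le_max_right _ _)) (le_max_left _ _)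
  set N : ℕ := 3 * n with hN
  have hNpos : 0 < N := by omega
  have hNreal : (N : ℝ) = 3 * n := by rw [hN]; push_cast; ring
  have hnpos : (0 : ℝ) < n := by exact_mod_cast hn1
  -- the support `S` (exactly one of the three indicators), tight labels, the type `Q = (n,n,n)`
  set S : Finset (Bool × Bool × Bool) :=
    {(true, false, false), (false, true, false), (false, false, true)} with hS
  let α : Bool → Fin 1 → ℤ := fun t _ => if t then 2 else -1
  have hαinj : Function.Injective α := by
    intro t t' h
    have := congrFun h 0
    revert this; cases t <;> cases t' <;> simp [α]
  have hαb : ∀ t ρ, |α t ρ| ≤ ((2 : ℕ) : ℤ) := by intro t ρ; cases t <;> simp [α]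
  have htight : ∀ s ∈ S, ∀ ρ : Fin 1, α s.1 ρ + α s.2.1 ρ + α s.2.2 ρ = 0 := by
    intro s hs ρ
    simp only [hS, Finset.mem_insert, Finset.mem_singleton] at hs
    rcases hs with rfl | rfl | rfl <;> simp [α]
  let Q : Bool × Bool × Bool → ℕ := fun s => if s ∈ S then n else 0
  have hQS : ∀ s, s ∉ S → Q s = 0 := fun s hs => by simp [Q, hs]
  have hQ : ∑ s, Q s = N := by
    simp only [Q, hS, Fintype.sum_prod_type, Fintype.sum_bool, Finset.mem_insert, Finset.mem_singleton,
      Prod.mk.injEq]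
    simp
    omega
  let P : Bool × Bool × Bool → ℝ := fun s => (Q s : ℝ) / N
  -- the free diagonal (Coppersmith–Winograd hashing + Salem–Spencer, Behrend)
  obtain ⟨Δ, hΔQ, hfree, hsize⟩ :=
    exists_free_diagonal_jointType_card S α α α hαinj hαinj hαinj hαb hαb htight hNpos Q hQS hQ P
      (fun s => rfl)
  -- the rows of `Δ` are balanced with letters in `S`
  have hts := jointTypeClass_subset_typedSupport S Q hQS (N := N)
  have hμ : (∑ j : Bool, ∑ l : Bool, Q (true, j, l)) = n := by
    simp only [Q, hS, Fintype.sum_bool, Finset.mem_insert, Finset.mem_singleton, Prod.mk.injEq]; simp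
  have hν : (∑ i : Bool, ∑ l : Bool, Q (i, true, l)) = n := by
    simp only [Q, hS, Fintype.sum_bool, Finset.mem_insert, Finset.mem_singleton, Prod.mk.injEq]; simp
  have hπ : (∑ i : Bool, ∑ j : Bool, Q (i, j, true)) = n := by
    simp only [Q, hS, Fintype.sum_bool, Finset.mem_insert, Finset.mem_singleton, Prod.mk.injEq]; simp
  have hone : ∀ δ ∈ Δ, ∀ ρ, (δ.1 ρ, δ.2.1 ρ, δ.2.2 ρ) ∈ S := fun δ hδ =>
    (mem_typedSupport.1 (hts (hΔQ hδ))).2.2.2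
  have hcount : ∀ δ ∈ Δ, letterCount δ.1 true = n ∧ letterCount δ.2.1 true = n ∧
      letterCount δ.2.2 true = n := by
    intro δ hδ
    obtain ⟨h1, h2, h3, -⟩ := mem_typedSupport.1 (hts (hΔQ hδ))
    refine ⟨?_, ?_, ?_⟩
    · rw [congrFun h1 true]; exact hμ
    · rw [congrFun h2 true]; exact hν
    · rw [congrFun h3 true]; exact hπ
  -- hence a USP with `|Δ|` rows
  rw [hS] at hone hfree
  have hloc := localUSP_of_freeDiagonal hN Δ hone hcount hfree Δ.equivFin.symm
  refine ⟨N, le_trans hnK (by omega), Δ.card, _, hloc, ?_⟩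
  -- size: the marginals of `P` are `(1/3, 2/3)`, the penalty vanishes
  let g : Bool → ℝ := fun t => if t then 1 / 3 else 2 / 3
  have hoffS : ∀ x, x ∉ S → P x = 0 := fun x hx => by simp [P, hQS x hx]
  have hPval : ∀ x, P x = if x ∈ S then 1 / 3 else 0 := by
    intro x
    simp only [P, Q]
    split_ifs with hx
    · rw [hNreal]; field_simp
    · simp
  have hm₁ : marginalDist₁ P = g := by
    funext t
    cases t <;> norm_num [marginalDist₁, hPval, hS, Fintype.sum_bool, g]
  have hm₂ : marginalDist₂ P = g := by
    funext t
    cases t <;> norm_num [marginalDist₂, hPval, hS, Fintype.sum_bool, g]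
  have hm₃ : marginalDist₃ P = g := by
    funext t
    cases t <;> norm_num [marginalDist₃, hPval, hS, Fintype.sum_bool, g]
  have hHg : shannonEntropy g = (negMulLog (1 / 3 : ℝ) + negMulLog (2 / 3)) / Real.log 2 := by
    simp only [shannonEntropy, Fintype.sum_bool, g]
    simp
  -- `P` is a distribution supported in `S`, and `D(P) = {P}`
  have hPsimp : P ∈ stdSimplex ℝ (Bool × Bool × Bool) := by
    refine ⟨fun x => by rw [hPval]; split_ifs <;> norm_num, ?_⟩
    simp only [hPval, hS, Fintype.sum_prod_type, Fintype.sum_bool, Finset.mem_insert, Finset.mem_singleton,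
      Prod.mk.injEq]
    simp; norm_num
  have hD : ∀ P' ∈ sameMarginalsOn S P, P' = P := by
    intro P' hP'
    obtain ⟨-, hoff, hm1, hm2, hm3⟩ := hP'
    have e1 := congrFun hm1 true
    have e2 := congrFun hm2 true
    have e3 := congrFun hm3 true
    simp only [marginalDist₁, marginalDist₂, marginalDist₃, Fintype.sum_bool] at e1 e2 e3
    have z : ∀ x, x ∉ S → P' x = 0 := hoff
    have zTTT := z (true, true, true) (by simp [hS])
    have zTTF := z (true, true, false) (by simp [hS])
    have zTFT := z (true, false, true) (by simp [hS])
    have zFTT := z (false, true, true) (by simp [hS])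
    have zFFF := z (false, false, false) (by simp [hS])
    have pTTT := hoffS (true, true, true) (by simp [hS])
    have pTTF := hoffS (true, true, false) (by simp [hS])
    have pTFT := hoffS (true, false, true) (by simp [hS])
    have pFTT := hoffS (false, true, true) (by simp [hS])
    have pFFF := hoffS (false, false, false) (by simp [hS])
    funext ⟨a, b, c⟩
    cases a <;> cases b <;> cases c
    · rw [zFFF, pFFF]
    · -- (F,F,T)
      linarith
    · -- (F,T,F)
      linarith
    · rw [zFTT, pFTT]
    · -- (T,F,F)
      linarith
    · rw [zTFT, pTFT]
    · rw [zTTF, pTTF]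
    · rw [zTTT, pTTT]
  have hΓ : maxEntropyPenalty S P ≤ 0 := by
    have hle : maxEntropyGivenMarginals S P ≤ shannonEntropy P :=
      maxEntropyGivenMarginals_le ⟨P, self_mem_sameMarginalsOn hPsimp hoffS⟩
        (fun P' hP' => by rw [hD P' hP'])
    simp only [maxEntropyPenalty]; linarith
  -- the exponent: `N · (min H − Γ) ≥ N · H(1/3,2/3)`, so `c₀^N ≤ 2^{…}`
  set h₀ : ℝ := (negMulLog (1 / 3 : ℝ) + negMulLog (2 / 3)) / Real.log 2 with hh₀
  have hc₀eq : (2 : ℝ) ^ h₀ = c₀ := by rw [hh₀, hc₀]; exact two_rpow_entropy_third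
  have hmin : min (shannonEntropy (marginalDist₁ P))
      (min (shannonEntropy (marginalDist₂ P)) (shannonEntropy (marginalDist₃ P))) = h₀ := by
    rw [hm₁, hm₂, hm₃, hHg, min_self, min_self]
  have hlhs : c₀ ^ N ≤ (2 : ℝ) ^ ((N : ℝ) * (min (shannonEntropy (marginalDist₁ P))
      (min (shannonEntropy (marginalDist₂ P)) (shannonEntropy (marginalDist₃ P))) -
        maxEntropyPenalty S P)) := by
    rw [hmin, ← hc₀eq, ← Real.rpow_natCast ((2 : ℝ) ^ h₀) N, ← Real.rpow_mul (by norm_num : (0:ℝ) ≤ 2)]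
    apply Real.rpow_le_rpow_of_exponent_le (by norm_num : (1 : ℝ) ≤ 2)
    have : (N : ℝ) * h₀ ≤ (N : ℝ) * (h₀ - maxEntropyPenalty S P) := by
      apply mul_le_mul_of_nonneg_left _ (Nat.cast_nonneg N); linarith
    simpa [mul_comm] using this
  -- the sub-exponential factor
  have hcard8 : Fintype.card (Bool × Bool × Bool) = 8 := by simp [Fintype.card_prod, Fintype.card_bool]
  have hE : c₀ ^ N ≤ (Δ.card : ℝ) * ((((N : ℝ) + 1) ^ 22 * 192) *
      Real.exp (4 * √(Real.log 6 + N * Real.log 8))) := by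
    refine hlhs.trans (hsize.trans_eq ?_)
    simp only [hcard8, Fintype.card_bool]
    norm_num
  have hsub : (((N : ℝ) + 1) ^ 22 * 192) * Real.exp (4 * √(Real.log 6 + N * Real.log 8)) ≤
      (c₀ / C) ^ N := by
    have hNN₁ : N₁ ≤ N := le_trans hnN₁ (by omega)
    have hNN₂ : N₂ ≤ N := le_trans hnN₂ (by omega)
    have hNN₃ : N₃ ≤ N := le_trans hnN₃ (by omega)
    have h1 := hN₁ N hNN₁
    have h2 := hN₂ N hNN₂
    have h3 := hN₃ N hNN₃
    have hratio : (c₀ / C) ^ N = (C₂ / C₁) ^ N * (C₁ / C) ^ N * (c₀ / C₂) ^ N := by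
      rw [← mul_pow, ← mul_pow]; congr 1; field_simp
    rw [hratio]
    have hp1 : (0 : ℝ) ≤ (C₁ / C) ^ N := by positivity
    have hp2 : (0 : ℝ) ≤ (C₂ / C₁) ^ N := by positivity
    exact mul_le_mul (mul_le_mul h2 h1 (by norm_num) hp2) h3 (by positivity) (by positivity)
  -- conclude `C^N ≤ |Δ|`
  have hfin : c₀ ^ N ≤ (Δ.card : ℝ) * (c₀ / C) ^ N := by
    exact hE.trans (mul_le_mul_of_nonneg_left hsub (Nat.cast_nonneg _))
  -- `C^N * c₀^N ≤ |Δ| * c₀^N`, then cancel `c₀^N > 0`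
  have hc₀N : (0 : ℝ) < c₀ ^ N := pow_pos hc₀pos N
  have hCN : (0 : ℝ) < C ^ N := pow_pos hCpos N
  have e1 : (c₀ / C) ^ N * C ^ N = c₀ ^ N := by
    rw [← mul_pow]; congr 1; field_simp
  have h2 : C ^ N * c₀ ^ N ≤ (Δ.card : ℝ) * c₀ ^ N := by
    calc C ^ N * c₀ ^ N = c₀ ^ N * C ^ N := mul_comm _ _
      _ ≤ ((Δ.card : ℝ) * (c₀ / C) ^ N) * C ^ N := mul_le_mul_of_nonneg_right hfin hCN.le
      _ = (Δ.card : ℝ) * ((c₀ / C) ^ N * C ^ N) := by ring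
      _ = (Δ.card : ℝ) * c₀ ^ N := by rw [e1]
  exact le_of_mul_le_mul_right h2 hc₀N

/-- **Cohn–Kleinberg–Szegedy–Umans 2005, Theorem 3.3 / 13 (Coppersmith and Winograd [CW90]), lower half:
"The USP capacity equals `3/2^{2/3}`"** — together with Lemma 3.2 / 12 (`IsUSP.eventually_card_lt_pow`,
the upper half).  In CKSU's capacity language: for every `0 ≤ C < 3/2^{2/3}` and every `K` there is a USP
of some width `k ≥ K` with at least `C^k` rows (from `exists_localUSP_card_ge_pow` and "local USPs are
USPs"; `C = 0`: the empty puzzle).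
[cite: CohnKleinbergSzegedyUmans2005, Theorem 13 (§3, arXiv:math/0511460 p. 6; = FOCS Thm. 3.3)] -/
theorem exists_isUSP_card_ge_pow (C : ℝ) (hC0 : 0 ≤ C) (hC : C < 3 / (2 : ℝ) ^ (2 / 3 : ℝ)) (K : ℕ) :
    ∃ k ≥ K, ∃ s : ℕ, ∃ row : Fin s → Fin k → Fin 3, IsUSP row ∧ C ^ k ≤ (s : ℝ) := by
  rcases hC0.eq_or_lt with h0 | hCpos
  · -- `C = 0`: the empty puzzle of width `K + 1`
    refine ⟨K + 1, by omega, 0, fun u => u.elim0, ?_, ?_⟩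
    · intro π₁ π₂ π₃
      exact Or.inl ⟨Subsingleton.elim _ _, Subsingleton.elim _ _⟩
    · rw [← h0, zero_pow (by omega)]; simp
  · obtain ⟨k, hk, s, row, hloc, hs⟩ := exists_localUSP_card_ge_pow C hCpos hC K
    exact ⟨k, hk, s, row, isUSP_of_localUSP hloc, hs⟩

/-- **Cohn–Kleinberg–Szegedy–Umans 2005, Theorem 3.3 / 13 (Coppersmith and Winograd [CW]), AS PRINTED:
"The USP capacity equals `3/2^{2/3}`"** — both halves in the `∀ C`-unfolding of CKSU's definition of
capacity: below `3/2^{2/3}` there are USPs of size `≥ C^k` at arbitrarily large widths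
(`exists_isUSP_card_ge_pow`), above it every USP of large width `k` has fewer than `C^k` rows
(Lemma 3.2 / 12, `IsUSP.eventually_card_lt_pow`).
[cite: CohnKleinbergSzegedyUmans2005, Theorem 13 (§3, arXiv:math/0511460 p. 6; = FOCS Thm. 3.3)] -/
theorem CohnKleinbergSzegedyUmans2005_thm13 :
    (∀ C : ℝ, 0 ≤ C → C < 3 / (2 : ℝ) ^ (2 / 3 : ℝ) → ∀ K : ℕ,
      ∃ k ≥ K, ∃ s : ℕ, ∃ row : Fin s → Fin k → Fin 3, IsUSP row ∧ C ^ k ≤ (s : ℝ)) ∧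
    (∀ C : ℝ, 3 / (2 : ℝ) ^ (2 / 3 : ℝ) < C →
      ∃ K : ℕ, ∀ k ≥ K, ∀ {s : ℕ} {row : Fin s → Fin k → Fin 3}, IsUSP row → (s : ℝ) < C ^ k) :=
  ⟨fun C hC0 hC K => exists_isUSP_card_ge_pow C hC0 hC K, fun _ hC => IsUSP.eventually_card_lt_pow hC⟩

end Main

end Literature.Computability.AlgebraicComplexity
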